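import Summits.QuantumFields.YangMills.Theorems.BalabanUVNodesN15KingModelBoxFolding
import Literature.MathematicalPhysics.QuantumFieldTheory.King1986.TorusCongr
import HarnessLib

/-!
# BalabanUVNodes ∕ N15 — THE KING-MODEL RUNG (PART Ν-k): KING's FINE LAYERS ON THE REGION `Ω_η` — `A₀`, THE BLOCK-CONSTRAINED PROPAGATOR `G^η_k = N^dA₀⁻¹`,
# `C^η = N^dB⁻¹` AND THE TOP PIECE `G^η_{(K)} = C^η − G^η_K` (NE2's site ∕ operator-layer kernels) ARE FOLDS OF THE TORUS KERNELS: inverses by images, the top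
# piece as the difference of two box kernels, and every torus bound carried over
# (Track A, DAG node N15 = NE2; FAN-OUT v1.1 §N15 s3 «KING-MODEL RUNG» — NE2's analogue decided in the model, on King's actual region; count-neutral)

HONEST FRAMING.  Count-neutral (cell `pub-ymgap`, seat `pub-ymgap-dag-n15-e` g39; `--supports stmt-QuantumFields-27366 --as helper` = K3⁸).
TEMPLATE LITERATURE: C. King, Commun. Math. Phys. **102** (1986) 649–677 [King1986]: (2.13) p.653 (`A₀`, `G^ε_k = N^dA₀⁻¹`), (2.17) p.653 (`C^η`), (4.44)–(4.45)
p.675 (the top piece), (2.20) p.654 (re-indexing of lattices), §4 p.670 l.8–13 (the Ω-propagators `G^η_k(Ω)` as multiple-reflection sums after [Ba 4] (2.42);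
estimates proved for one kernel; here in the periodized doubled-TORUS form of these files, part Ν-f — NOT King's ∕ [Ba 4]'s infinite-lattice series).  The g0 rung of
this seat typed NE2's SITE and OPERATOR layers in King's model on the TORUS (`topPiece_step_le`, `ne2PlusSite∕Operator_topPiece`).  THIS FILE puts King's fine
kernels on the fine box `Ω_η = Π_μ Fin (N·n′_μ)` (`n′_μ` unit blocks of `N` fine points per direction): (§1) the doubled torus of `Ω_η` is spelt `2·(Nn′)` while
King's fine torus over the doubled unit torus is spelt `N·(2n′)` — `King1986.TorusCongr.torCongr` identifies them (`toKing`), a kernel of King's torus is READ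
on the fine-box torus (`fromKing A = A.submatrix toKing toKing`), reading commutes with products, inverses, sums, and with the block-face reflections
(`torCongr_torRefl`), so King's reflection-covariant kernels become reflection symmetric in part Ν-f's sense, and `c(−Δ)+m²` does not see the spelling
(`fromKing_lapF`, by `lapF_torCongr`); (§2) hence by part Ν-f's homomorphism: ★★★ **`foldOp_fineOp_inv`** `(A₀^Ω)⁻¹ = fold(A₀⁻¹)` (`A₀^Ω := fold(A₀)`, a definition of these files),
★★★ **`foldOp_constrainedProp`** `G^η_k(Ω) = fold(G^η_k) = N^d·(A₀^Ω)⁻¹`, ★★ `foldOp_fromKing_lapF_inv` (`fold(B⁻¹) = G^{Ω_η}` = part Ν-a's image sum on the fine box),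
★★★ **`foldOp_topPiece`** `G^η_{(K)}(Ω) = fold(G^η_{(K)}) = N^d·(G^{Ω_η} − (A₀^Ω)⁻¹)` — NE2's covariance piece on King's region is the `2^{d+1}`-image sum of the
torus top piece (`foldOp_topPiece_eq_sum`) AND the difference of the two folded box kernels; (§3) ★★ `abs_foldOp_fromKing_le_exp` ∕ `abs_foldOp_topPiece_le_exp`:
every torus bound `C·e^{−δ·tdistT}` for a fine kernel ∕ the top piece holds on `Ω_η` with constant `× 2^{d+1}` (`tdistT_torCongr`: the distance does not see
the spelling).
NOT Bałaban's covariant objects; NOT a node discharge (N15 is booked through n15-a's knit, untouched); no torus estimate is instantiated here (the tree's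
uniform estimates for `G^η_k` and the top piece — `King1986.PropagatorDecayUniform`, `TopScalePiece.topPiece_rate_blocks` — are stated in BLOCK distance on
King's tori `Tor (fine L^k M)`; feeding them in is bookkeeping on periods and distances, displayed as the hypothesis `hA`); nothing continuum-YM ∕ `ℝ⁴` ∕ OS
axioms ∕ Clay.  0 `sorry`.

OBJECTS (data).  `toKing N n′ : Tor (dblPer (fine N n′)) ≃ Tor (fine N (dblPer n′))`; `fromKing N n′ A := A.submatrix toKing toKing`.

WHAT THIS FILE PROVES (kernel).  §1 `fine_dblPer_eq`, `fromKing_apply`, ★ `torCongr_torRefl`, ★ `isReflSymm_fromKing`, `fromKing_mul∕_inv∕_sub∕_smul`, `isUnit_fromKing`,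
★ `fromKing_lapF`, `fromKing_lapF_inv`.  §2 `isReflSymm_fromKing_fineOp`, ★★★ **`foldOp_fineOp_inv`**, ★★★ **`foldOp_constrainedProp`**, ★★ `foldOp_fromKing_lapF_inv`,
★★★ **`foldOp_topPiece`**, `foldOp_topPiece_eq_sum`.  §3 ★★ `abs_foldOp_fromKing_le_exp`, ★★ `abs_foldOp_topPiece_le_exp`.

HONEST SCOPE.  `a, c ≥ 0`, `m² > 0` for the inverses; any `d`, any `N ≥ 1`, any unit sides `n′_μ ≥ 1`.  King's `A = 0` scalar model; N15 untouched; counts unmoved.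
Locators: [King1986] (2.13) p.653, (2.17) p.653, (2.20) p.654, (4.44)–(4.45) p.675, Prop. 3.7 (3.60) p.663, §4 p.670.
-/

noncomputable section

open scoped BigOperators symmDiff
open Finset Matrix

namespace Summit.QuantumFields.YangMills.BalabanUVNodes.N15KingModelRung.TorusSpectral

open Literature.MathematicalPhysics.QuantumFieldTheory.Balaban1983to89.B5Prop11Plancherel (Tor fine unitVec)
open Literature.MathematicalPhysics.QuantumFieldTheory.Balaban1983to89.QGQInverse (Coercive isUnit_of_coercive)
open Literature.MathematicalPhysics.QuantumFieldTheory.King1986.Torus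
open Summit.QuantumFields.YangMills.BalabanUVNodes.N15.TwoGrid (torRefl torRefl_torRefl torRefl_apply_same torRefl_apply_ne)
open Summit.QuantumFields.YangMills.BalabanUVNodes.N15.KingModel.SrcDiv (lapF_torRefl fineOp_torRefl fineOp_inv_torRefl)
open Summit.QuantumFields.YangMills.BalabanUVNodes.N15KingModelRung.Curved (lapF_inv_torRefl constrainedProp_torRefl topPiece_torRefl)

variable {d : ℕ}

/-! ## §1 The two spellings of the doubled fine torus: `N·(2n′)` versus `2·(Nn′)` -/

section Spellings

variable (N : ℕ) [NeZero N] (n' : Fin (d + 1) → ℕ) [hn : ∀ μ, NeZero (n' μ)]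

omit [NeZero N] hn in
/-- `fine N (dblPer n′) μ = N·(2n′_μ) = 2·(Nn′_μ) = dblPer (fine N n′) μ`. [folklore] -/
theorem fine_dblPer_eq (μ : Fin (d + 1)) : fine N (dblPer n') μ = dblPer (fine N n') μ := Nat.mul_left_comm _ _ _

/-- THE RE-INDEXING of the doubled torus of the fine box `Ω_η = Π_μ Fin (N·n′_μ)` (spelt `2·(Nn′)`) onto King's fine torus over the doubled unit torus (spelt
`N·(2n′)`): `King1986.Torus.torCongr` along `fine_dblPer_eq`. [cite: King1986, (2.20) p.654] -/
def toKing : Tor (dblPer (fine N n')) ≃ Tor (fine N (dblPer n')) := torCongr fun μ => (fine_dblPer_eq N n' μ).symm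

/-- A kernel of King's fine torus READ on the doubled torus of the fine box. [cite: King1986, (2.20) p.654] -/
def fromKing (A : Matrix (Tor (fine N (dblPer n'))) (Tor (fine N (dblPer n'))) ℝ) : Matrix (Tor (dblPer (fine N n'))) (Tor (dblPer (fine N n'))) ℝ :=
  A.submatrix (toKing N n') (toKing N n')

omit [NeZero N] hn in
/-- Entries. [folklore] -/
theorem fromKing_apply (A : Matrix (Tor (fine N (dblPer n'))) (Tor (fine N (dblPer n'))) ℝ) (x y : Tor (dblPer (fine N n'))) :
    fromKing N n' A x y = A (toKing N n' x) (toKing N n' y) := rfl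

omit [NeZero N] hn in
/-- `torCongr` commutes with the block-face reflections (it preserves coordinate values and is a ring map coordinatewise). [folklore] -/
theorem torCongr_torRefl {K K' : Fin (d + 1) → ℕ} (h : ∀ μ, K μ = K' μ) (κ : Fin (d + 1)) (x : Tor K) :
    torCongr h (torRefl K κ x) = torRefl K' κ (torCongr h x) := by
  funext μ
  by_cases hμ : μ = κ
  · subst hμ
    rw [torCongr_apply, torRefl_apply_same, torRefl_apply_same, torCongr_apply, map_sub, map_neg, map_one]
  · rw [torCongr_apply, torRefl_apply_ne _ hμ, torRefl_apply_ne _ hμ, torCongr_apply]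

omit [NeZero N] hn in
/-- ★ A reflection-covariant kernel of King's fine torus is reflection symmetric on the doubled torus of the fine box. [cite: King1986, §4 p.670] -/
theorem isReflSymm_fromKing {A : Matrix (Tor (fine N (dblPer n'))) (Tor (fine N (dblPer n'))) ℝ}
    (hA : ∀ (κ : Fin (d + 1)) (x y : Tor (fine N (dblPer n'))), A (torRefl (fine N (dblPer n')) κ x) (torRefl (fine N (dblPer n')) κ y) = A x y) :
    IsReflSymm (fine N n') (fromKing N n' A) := by
  refine isReflSymm_of_torRefl (fine N n') fun κ x y => ?_
  rw [fromKing_apply, fromKing_apply]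
  show A (torCongr _ (torRefl _ κ x)) (torCongr _ (torRefl _ κ y)) = A (torCongr _ x) (torCongr _ y)
  rw [torCongr_torRefl, torCongr_torRefl, hA]

/-- `fromKing` is multiplicative. [folklore] -/
theorem fromKing_mul (A B : Matrix (Tor (fine N (dblPer n'))) (Tor (fine N (dblPer n'))) ℝ) :
    fromKing N n' (A * B) = fromKing N n' A * fromKing N n' B :=
  (Matrix.submatrix_mul_equiv A B (toKing N n') (toKing N n') (toKing N n')).symm

/-- `fromKing` commutes with inversion. [folklore] -/
theorem fromKing_inv (A : Matrix (Tor (fine N (dblPer n'))) (Tor (fine N (dblPer n'))) ℝ) : fromKing N n' A⁻¹ = (fromKing N n' A)⁻¹ := by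
  rw [fromKing, fromKing, Matrix.inv_submatrix_equiv]

omit [NeZero N] hn in
/-- `fromKing` is additive. [folklore] -/
theorem fromKing_sub (A B : Matrix (Tor (fine N (dblPer n'))) (Tor (fine N (dblPer n'))) ℝ) : fromKing N n' (A - B) = fromKing N n' A - fromKing N n' B := rfl

omit [NeZero N] hn in
/-- `fromKing` is homogeneous. [folklore] -/
theorem fromKing_smul (r : ℝ) (A : Matrix (Tor (fine N (dblPer n'))) (Tor (fine N (dblPer n'))) ℝ) : fromKing N n' (r • A) = r • fromKing N n' A := rfl

/-- `fromKing` preserves invertibility. [folklore] -/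
theorem isUnit_fromKing {A : Matrix (Tor (fine N (dblPer n'))) (Tor (fine N (dblPer n'))) ℝ} (hA : IsUnit A) : IsUnit (fromKing N n' A) :=
  (Matrix.isUnit_submatrix_equiv (toKing N n') (toKing N n')).mpr hA

/-- ★ **`c(−Δ)+m²` DOES NOT SEE THE SPELLING**: `fromKing (B on King's fine torus) = B on the doubled torus of the fine box` (`lapF_torCongr`), so its fold is
part Ν-a's `kingBoxGreen`-calculus on `Ω_η`. [cite: King1986, (2.20) p.654, (2.13) p.653] -/
theorem fromKing_lapF (c m2 : ℝ) : fromKing N n' (lapF (fine N (dblPer n')) c m2) = lapF (dblPer (fine N n')) c m2 := by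
  ext x y
  rw [fromKing_apply]
  exact lapF_torCongr (fun μ => (fine_dblPer_eq N n' μ).symm) c m2 x y

/-- `fromKing(B⁻¹) = (B on the doubled fine-box torus)⁻¹`. [cite: King1986, (2.20) p.654] -/
theorem fromKing_lapF_inv (c m2 : ℝ) : fromKing N n' (lapF (fine N (dblPer n')) c m2)⁻¹ = (lapF (dblPer (fine N n')) c m2)⁻¹ := by
  rw [fromKing_inv, fromKing_lapF]

end Spellings

/-! ## §2 King's `A₀`, `G^η_k = N^dA₀⁻¹`, `C^η = N^dB⁻¹` and the top piece `G^η_{(K)} = C^η − G^η_K` on the fine box by folding -/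

section FineLayers

variable (N : ℕ) [NeZero N] (n' : Fin (d + 1) → ℕ) [hn : ∀ μ, NeZero (n' μ)]

/-- King's `A₀ = c(−Δ) + m² + a·Q*Q` is reflection symmetric (read on the doubled fine-box torus). [cite: King1986, (2.13) p.653, §4 p.670] -/
theorem isReflSymm_fromKing_fineOp (a c m2 : ℝ) : IsReflSymm (fine N n') (fromKing N n' (fineOp N (dblPer n') a c m2)) :=
  isReflSymm_fromKing N n' fun κ x y => fineOp_torRefl κ N (dblPer n') a c m2 x y

/-- ★★★ **KING's `A₀` ON THE REGION `Ω_η` AND ITS INVERSE BY IMAGES**: `A₀^Ω := fold(A₀)` (King's definition), and `(A₀^Ω)⁻¹ = fold(A₀⁻¹)`, i.e.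
`(A₀^Ω)⁻¹(x,y) = Σ_S A₀⁻¹(x, σ_S y)` summed over the `2^{d+1}` images in the doubled torus (`a, c ≥ 0`, `m² > 0`). [cite: King1986, (2.13) p.653, §4 p.670] -/
theorem foldOp_fineOp_inv {a c m2 : ℝ} (ha : 0 ≤ a) (hc : 0 ≤ c) (hm : 0 < m2) :
    (foldOp (fine N n') (fromKing N n' (fineOp N (dblPer n') a c m2)))⁻¹ = foldOp (fine N n') (fromKing N n' (fineOp N (dblPer n') a c m2)⁻¹) := by
  rw [foldOp_inv (fine N n') (isReflSymm_fromKing_fineOp N n' a c m2) (isUnit_fromKing N n' (fineOp_isUnit N (dblPer n') ha hc hm)), fromKing_inv]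

/-- ★★★ **KING's BLOCK-CONSTRAINED PROPAGATOR `G^η_k = N^d·A₀⁻¹` ON `Ω_η` IS THE IMAGE SUM OF THE TORUS ONE, AND EQUALS `N^d·(A₀^Ω)⁻¹`** — NE2's OPERATOR-LAYER
kernel on King's region. [cite: King1986, (2.13) p.653, (4.44) p.675, §4 p.670] -/
theorem foldOp_constrainedProp {a c m2 : ℝ} (ha : 0 ≤ a) (hc : 0 ≤ c) (hm : 0 < m2) :
    foldOp (fine N n') (fromKing N n' (constrainedProp N (dblPer n') a c m2))
      = ((N : ℝ) ^ (d + 1)) • (foldOp (fine N n') (fromKing N n' (fineOp N (dblPer n') a c m2)))⁻¹ := by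
  rw [constrainedProp, fromKing_smul, foldOp_smul, foldOp_fineOp_inv N n' ha hc hm]

/-- ★★ **KING's `C^η = N^d·B⁻¹` ON `Ω_η` IS `N^d·G^{Ω_η}`** — the operator-free covariance on the fine box is part Ν-a's image sum. [cite: King1986, (2.17) p.653, §4 p.670] -/
theorem foldOp_fromKing_lapF_inv (c m2 : ℝ) (x y : KingBox (fine N n')) :
    foldOp (fine N n') (fromKing N n' (lapF (fine N (dblPer n')) c m2)⁻¹) x y = kingBoxGreen (fine N n') c m2 x y := by
  rw [fromKing_lapF_inv]; rfl

/-- ★★★ **THE TOP PIECE `G^η_{(K)} = C^η − G^η_K` ON `Ω_η` (NE2's COVARIANCE PIECE ON KING's REGION) IS THE IMAGE SUM OF THE TORUS TOP PIECE, AND EQUALS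
`N^d·(G^{Ω_η} − (A₀^Ω)⁻¹)`** — the difference of the two folded box kernels. [cite: King1986, (4.44) p.675, (2.17) p.653, §4 p.670] -/
theorem foldOp_topPiece {a c m2 : ℝ} (ha : 0 ≤ a) (hc : 0 ≤ c) (hm : 0 < m2) (x y : KingBox (fine N n')) :
    foldOp (fine N n') (fromKing N n' (topPiece N (dblPer n') a c m2)) x y
      = ((N : ℝ) ^ (d + 1)) * (kingBoxGreen (fine N n') c m2 x y - (foldOp (fine N n') (fromKing N n' (fineOp N (dblPer n') a c m2)))⁻¹ x y) := by
  rw [topPiece, fromKing_smul, foldOp_smul, Matrix.smul_apply, smul_eq_mul, fromKing_sub, fromKing_lapF_inv,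
    foldOp_fineOp_inv N n' ha hc hm]
  congr 1
  simp only [foldOp, Matrix.sub_apply, Finset.sum_sub_distrib]
  rfl

/-- Entrywise: the top piece on `Ω_η` is the `2^{d+1}`-image sum of King's torus top piece. [cite: King1986, (4.44) p.675, §4 p.670] -/
theorem foldOp_topPiece_eq_sum (a c m2 : ℝ) (x y : KingBox (fine N n')) :
    foldOp (fine N n') (fromKing N n' (topPiece N (dblPer n') a c m2)) x y
      = ∑ S : Finset (Fin (d + 1)), topPiece N (dblPer n') a c m2 (toKing N n' (dblBox (fine N n') x))
          (toKing N n' (torReflS (dblPer (fine N n')) S (dblBox (fine N n') y))) := rfl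

end FineLayers

/-! ## §3 Torus bounds for King's fine kernels carry over to `Ω_η` -/

section FineTransport

variable (N : ℕ) [NeZero N] (n' : Fin (d + 1) → ℕ) [hn : ∀ μ, NeZero (n' μ)]

/-- ★★ **TRANSFER OF TORUS BOUNDS FOR ANY FINE KERNEL** (King p.670: estimates need only be proved for one kernel, the image sums inherit them): a bound `|A(x,y)| ≤ C·e^{−δ·tdistT(x,y)}` on King's fine torus `Tor (fine N (2n′))` gives
`|fold(A)(s,t)| ≤ 2^{d+1}·C·e^{−δ·tdistT(dblBox s, dblBox t)}` on the fine box (`tdistT` does not see the spelling, `tdistT_torCongr`). [cite: King1986, §4 p.670, Prop. 3.7 (3.60) p.663] -/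
theorem abs_foldOp_fromKing_le_exp (A : Matrix (Tor (fine N (dblPer n'))) (Tor (fine N (dblPer n'))) ℝ) {C δ : ℝ} (hC : 0 ≤ C) (hδ : 0 ≤ δ)
    (hA : ∀ x y : Tor (fine N (dblPer n')), |A x y| ≤ C * Real.exp (-(δ * tdistT (fine N (dblPer n')) x y))) (s t : KingBox (fine N n')) :
    |foldOp (fine N n') (fromKing N n' A) s t|
      ≤ 2 ^ (d + 1) * (C * Real.exp (-(δ * tdistT (dblPer (fine N n')) (dblBox (fine N n') s) (dblBox (fine N n') t)))) := by
  refine abs_foldOp_le_exp_of_torusDecay (fine N n') _ hC hδ (fun w w' => ?_) s t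
  rw [fromKing_apply]
  have h := hA (toKing N n' w) (toKing N n' w')
  rwa [show tdistT (fine N (dblPer n')) (toKing N n' w) (toKing N n' w') = tdistT (dblPer (fine N n')) w w' from
    tdistT_torCongr (fun μ => (fine_dblPer_eq N n' μ).symm) w w'] at h

/-- ★★ **THE TOP PIECE ON `Ω_η` INHERITS EVERY TORUS BOUND**: `|G^η_{(K)}(x,y)| ≤ C·e^{−δ·tdistT(x,y)}` on King's fine torus ⟹
`|G^η_{(K),Ω}(s,t)| ≤ 2^{d+1}·C·e^{−δ·tdistT(dblBox s, dblBox t)}`. [cite: King1986, (4.44)–(4.45) p.675, §4 p.670] -/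
theorem abs_foldOp_topPiece_le_exp (a c m2 : ℝ) {C δ : ℝ} (hC : 0 ≤ C) (hδ : 0 ≤ δ)
    (hA : ∀ x y : Tor (fine N (dblPer n')), |topPiece N (dblPer n') a c m2 x y| ≤ C * Real.exp (-(δ * tdistT (fine N (dblPer n')) x y)))
    (s t : KingBox (fine N n')) :
    |foldOp (fine N n') (fromKing N n' (topPiece N (dblPer n') a c m2)) s t|
      ≤ 2 ^ (d + 1) * (C * Real.exp (-(δ * tdistT (dblPer (fine N n')) (dblBox (fine N n') s) (dblBox (fine N n') t)))) :=
  abs_foldOp_fromKing_le_exp N n' _ hC hδ hA s t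

end FineTransport

end Summit.QuantumFields.YangMills.BalabanUVNodes.N15KingModelRung.TorusSpectral
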